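import Literature.Probability.LatticeModels.RandomClusterBlobPushingStep
import HarnessLib

/-!
# Pushing boundary conditions across a collar, with an inner wired blob (proved)

Topic `Literature/Probability/LatticeModels` (trunk `StatMech`, family `crit-ising`). The monotone
boundary-condition toolkit of Kesten's ratio-limit scheme (H. Kesten, *The incipient infinite cluster
in two-dimensional percolation*, PTRF 73 (1986), proof of Lemma (23), eq. (31): "the boundary
condition far away changes the probability of an inner event only by a bounded factor") for the
finite-graph random-cluster measure `φ^B_{G,p,q} = rcMeasure G p q B`, `q ≥ 1`, of the graph
`⟨E⟩ = fromEdgeSet ↑E` spanned by a finite edge set `E`, WITHOUT planarity and WITH AN INNER WIRED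
BLOB `B₀` kept on both sides (the blob is the inner wired rim of an explored datum in the
quasi-multiplicativity step of the FK arm-origin-forgetting argument). The geometry is the abstract
collar of `RandomClusterBoundaryPushingTools.lean`: a CORE vertex set, a disjoint COLLAR `Ann` such
that every `E`-edge at a core vertex has both endpoints in `Core ∪ Ann`, an outer wired set `W` off
`Core ∪ Ann`, a blob `B₀ ⊆ Core`, `EA` = the `E`-edges touching the collar. The RSW-type input is:
under the collar measure `φ^{Annᶜ}_{⟨EA⟩}` (everything outside the collar wired) an open RADIAL
CROSSING — an `⟨E⟩`-walk from `Core` to the outside of `Core ∪ Ann` with interior in `Ann` and open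
edges — has probability `≤ 1 - c`.

* `rcMeasure_real_wired_le_free_of_radialBound'` — (A⁺) for INCREASING `I` determined by the
  `E`-edges inside the core, `c · φ^{B₀ ∪ W}_{⟨E⟩}(I) ≤ φ^{B₀}_{⟨E⟩}(I)`;
* `rcMeasure_real_free_le_wired_of_radialBound'` — (B'⁺) for DECREASING `D` determined inside the
  core, `c · φ^{B₀}_{⟨E⟩}(D) ≤ φ^{B₀ ∪ W}_{⟨E⟩}(D)`.

Proof ("the outer wiring shields itself", `RandomClusterBlobPushingStep.lean`). (1)
`φ^{B₀ ∪ W}(Cross ∩ F) ≤ (1 - c) φ^{B₀ ∪ W}(F)` for `F` determined inside the core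
(`blob_radialCrossing_inter_le`). (2) Explore the collar FROM OUTSIDE (`Rest = (Core ∪ Ann)ᶜ`): off
`Cross` the rim is empty; on each datum event `{𝒞 = X, 𝒟 = ∅}` no open edge crosses the vertex cut
at `X`, so by the closed-cut domain Markov property the unexplored configuration is the
random-cluster configuration of the sub-domain of the edges off `X` with wired set
`(B₀ ∪ W) ∖ X = B₀` (`blob_inter_explEvent_empty_eq_mul`); compare with `φ^{B₀}_{⟨E⟩}` by domain
monotonicity for a fixed wired set (`rcMeasure_fromEdgeSet_real_le`,
`rcMeasure_real_le_fromEdgeSet_of_isLowerSet`) and sum over the disjoint datum events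
(`blob_inter_compl_radialCrossing_le`, `blob_compl_radialCrossing_mul_le`). Everything is proved;
no definitions.

## References

* H. Kesten, The incipient infinite cluster in two-dimensional percolation, *Probab. Theory Related
  Fields* 73 (1986) 369–394: proof of Lemma (23), eq. (31); Lemma (29).
* G. Grimmett, *The Random-Cluster Model*, Springer (2006): Thm. (3.1)(a), Lemma (4.13),
  Lemma (4.14).
* D. Basu, A. Sapozhnikov, Kesten's incipient infinite cluster and quasi-multiplicativity of crossing
  probabilities, *Electron. Commun. Probab.* 22 (2017) no. 26, §2.
-/

noncomputable section

open MeasureTheory Finset SimpleGraph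
open Literature.Probability.Percolation (BondConfig openConnIn openGraph explSet explRim explEvent)

namespace Literature.Probability.LatticeModels

variable {V : Type*}

section Collar

variable [Fintype V] [DecidableEq V]

/-! ### Step 2: off the radial crossing, the outer wiring can be removed -/

/-- **Step 2 (increasing events): off the radial crossing, the outer wiring can be removed**
(Kesten 1986, proof of Lemma (23), eq. (31): "no crossing ⇒ the exploration from outside has empty
rim ⇒ the inner law is that of a sub-domain with only the inner blob wired"). For increasing `I`
determined by the `E`-edges inside the core, a blob `B₀ ⊆ Core` and a wired set `W` off
`Core ∪ Ann`, `φ^{B₀ ∪ W}_{⟨E⟩}(I ∖ Cross) ≤ φ^{B₀}_{⟨E⟩}(I)` (`p < 1`, `q ≥ 1`): cover `Crossᶜ` by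
the datum events `{𝒞 = X, 𝒟 = ∅}` of the outside-in exploration, factorise on each across the
closed cut at `X` (`blob_inter_explEvent_empty_eq_mul`, wired set `(B₀ ∪ W) ∖ X = B₀`), bound the
`B₀`-wired measure of the sub-domain by that of `⟨E⟩` (`rcMeasure_fromEdgeSet_real_le`) and sum the
disjoint datum events. [cite: Kesten1986, proof of Lemma (23), eq. (31)] -/
theorem blob_inter_compl_radialCrossing_le {p q : ℝ} (hp : p ∈ Set.Icc (0 : ℝ) 1)
    (hp1 : p < 1) (hq : 1 ≤ q) (E : Finset (Sym2 V)) (Core Ann W B₀ : Set V)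
    (hCA : ∀ v ∈ Core, v ∉ Ann) (hW : ∀ w ∈ W, w ∉ Core ∧ w ∉ Ann) (hB₀ : ∀ b ∈ B₀, b ∈ Core)
    (hCore : ∀ e ∈ E, (∃ v ∈ Core, v ∈ e) → ∀ x ∈ e, x ∈ Core ∨ x ∈ Ann)
    {I : Set (BondConfig V)} (hI : IsUpperSet I)
    (hIdet : ∀ ω₁ ω₂ : BondConfig V, (∀ e ∈ E, (∀ x ∈ e, x ∈ Core) → (e ∈ ω₁ ↔ e ∈ ω₂)) →
      (ω₁ ∈ I ↔ ω₂ ∈ I)) :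
    (rcMeasure (fromEdgeSet (E : Set (Sym2 V))) p q (B₀ ∪ W)).real
        (I ∩ {ω | ∃ (a b : V) (w : (fromEdgeSet (E : Set (Sym2 V))).Walk a b), a ∈ Core ∧
          b ∉ Core ∪ Ann ∧ (∀ z ∈ w.support, z = a ∨ z = b ∨ z ∈ Ann) ∧ ∀ e ∈ w.edges, e ∈ ω}ᶜ) ≤
      (rcMeasure (fromEdgeSet (E : Set (Sym2 V))) p q B₀).real I := by
  classical
  have hq0 : 0 < q := one_pos.trans_le hq
  haveI := isProbabilityMeasure_rcMeasure (fromEdgeSet (E : Set (Sym2 V))) hp hq0 (B₀ ∪ W)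
  set φ := rcMeasure (fromEdgeSet (E : Set (Sym2 V))) p q (B₀ ∪ W) with hφ
  set Rest : Set V := {v | v ∉ Core ∧ v ∉ Ann} with hRest
  have hRest' : ∀ v, v ∈ Rest ↔ v ∉ Core ∧ v ∉ Ann := fun v ↦ Iff.rfl
  have hWR : W ⊆ Rest := fun w hw ↦ hW w hw
  -- on each datum event, the inner law is the `B₀`-wired law of a sub-domain
  have h3 : ∀ X : Set V, φ.real (I ∩ explEvent Rest Ann X ∅) ≤
      φ.real (Set.univ ∩ explEvent Rest Ann X ∅) *
        (rcMeasure (fromEdgeSet (E : Set (Sym2 V))) p q B₀).real I := by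
    intro X
    rw [Set.univ_inter]
    by_cases hne : (explEvent Rest Ann X ∅).Nonempty
    · obtain ⟨ω₀, hω₀⟩ := hne
      obtain ⟨U, hU, hUE, hAgree⟩ := exists_region_off_explSet hCA hRest' hω₀.1 hIdet
      have hBX : (B₀ ∪ W) \ X = B₀ := blob_union_sdiff_explSet_eq hCA hRest' hWR hB₀ hω₀.1
      calc φ.real (I ∩ explEvent Rest Ann X ∅)
          = φ.real ({ω | ω ∩ ↑U ∈ I} ∩ explEvent Rest Ann X ∅) :=
            measureReal_congr <|
              rcMeasure_ae_eq_of_forall_subset_edgeSet _ hp hq0 (B₀ ∪ W) fun ω hω ↦ by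
                simp only [Set.mem_inter_iff, Set.mem_setOf_eq, hAgree ω hω]
        _ = φ.real (explEvent Rest Ann X ∅) *
              (rcMeasure (fromEdgeSet (U : Set (Sym2 V))) p q ((B₀ ∪ W) \ X)).real I :=
            blob_inter_explEvent_empty_eq_mul _ hp hq0 (B₀ ∪ W) X U hU I
        _ ≤ φ.real (explEvent Rest Ann X ∅) *
              (rcMeasure (fromEdgeSet (E : Set (Sym2 V))) p q B₀).real I := by
            rw [hBX]
            refine mul_le_mul_of_nonneg_left ?_ measureReal_nonneg
            calc (rcMeasure (fromEdgeSet (U : Set (Sym2 V))) p q B₀).real I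
                ≤ (rcMeasure (fromEdgeSet (E : Set (Sym2 V))) p q B₀).real {ω | ω ∩ ↑U ∈ I} :=
                  rcMeasure_fromEdgeSet_real_le _ hp hq B₀ U (hUE _)
                    (rcMeasure_real_cylinder_empty_pos _ hp hp1 hq0 B₀ U) hI
              _ = (rcMeasure (fromEdgeSet (E : Set (Sym2 V))) p q B₀).real I :=
                  measureReal_congr <|
                    rcMeasure_ae_eq_of_forall_subset_edgeSet _ hp hq0 B₀ fun ω hω ↦ hAgree ω hω
    · rw [Set.not_nonempty_iff_eq_empty.1 hne, Set.inter_empty, measureReal_empty, zero_mul]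
  -- the datum events are pairwise disjoint, of total mass at most one
  have h5 : φ.real (⋃ X ∈ (Finset.univ : Finset (Set V)), (Set.univ ∩ explEvent Rest Ann X ∅)) ≤ 1 :=
    measureReal_le_one
  calc φ.real (I ∩ {ω | ∃ (a b : V) (w : (fromEdgeSet (E : Set (Sym2 V))).Walk a b), a ∈ Core ∧
          b ∉ Core ∪ Ann ∧ (∀ z ∈ w.support, z = a ∨ z = b ∨ z ∈ Ann) ∧ ∀ e ∈ w.edges, e ∈ ω}ᶜ)
      ≤ φ.real (⋃ X ∈ (Finset.univ : Finset (Set V)), (I ∩ explEvent Rest Ann X ∅)) :=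
        rcMeasure_real_mono_of_forall_subset_edgeSet _ hp hq0 (B₀ ∪ W) fun ω hω hωI ↦
          blob_compl_radialCrossing_subset_iUnion hCA hCore hRest' Finset.univ
            (fun _ ↦ Finset.mem_univ _) hω hωI
    _ = ∑ X ∈ (Finset.univ : Finset (Set V)), φ.real (I ∩ explEvent Rest Ann X ∅) :=
        (blob_sum_explEvent_empty_eq φ Rest Ann _ I).symm
    _ ≤ ∑ X ∈ (Finset.univ : Finset (Set V)), φ.real (Set.univ ∩ explEvent Rest Ann X ∅) *
            (rcMeasure (fromEdgeSet (E : Set (Sym2 V))) p q B₀).real I :=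
        Finset.sum_le_sum fun X _ ↦ h3 X
    _ = φ.real (⋃ X ∈ (Finset.univ : Finset (Set V)), (Set.univ ∩ explEvent Rest Ann X ∅)) *
            (rcMeasure (fromEdgeSet (E : Set (Sym2 V))) p q B₀).real I := by
        rw [← Finset.sum_mul, blob_sum_explEvent_empty_eq φ Rest Ann _ Set.univ]
    _ ≤ 1 * (rcMeasure (fromEdgeSet (E : Set (Sym2 V))) p q B₀).real I :=
        mul_le_mul_of_nonneg_right h5 measureReal_nonneg
    _ = _ := one_mul _

/-- **Step 2 (decreasing events): the measure with the outer wiring charges a decreasing inner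
event at least as much as "no radial crossing" times the blob-wired measure** (Kesten 1986, proof
of Lemma (23), eq. (31)). For decreasing `D` determined by the `E`-edges inside the core, a blob
`B₀ ⊆ Core` and a wired set `W` off `Core ∪ Ann`,
`φ^{B₀ ∪ W}_{⟨E⟩}(Crossᶜ) · φ^{B₀}_{⟨E⟩}(D) ≤ φ^{B₀ ∪ W}_{⟨E⟩}(D)` (`p < 1`, `q ≥ 1`): on each datum
event `{𝒞 = X, 𝒟 = ∅}` of the outside-in exploration the inner law is the `B₀`-wired measure of a
sub-domain (closed cut at `X`), which charges `D` at least as much as `φ^{B₀}_{⟨E⟩}`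
(`rcMeasure_real_le_fromEdgeSet_of_isLowerSet`).
[cite: Kesten1986, proof of Lemma (23), eq. (31)] -/
theorem blob_compl_radialCrossing_mul_le {p q : ℝ} (hp : p ∈ Set.Icc (0 : ℝ) 1)
    (hp1 : p < 1) (hq : 1 ≤ q) (E : Finset (Sym2 V)) (Core Ann W B₀ : Set V)
    (hCA : ∀ v ∈ Core, v ∉ Ann) (hW : ∀ w ∈ W, w ∉ Core ∧ w ∉ Ann) (hB₀ : ∀ b ∈ B₀, b ∈ Core)
    (hCore : ∀ e ∈ E, (∃ v ∈ Core, v ∈ e) → ∀ x ∈ e, x ∈ Core ∨ x ∈ Ann)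
    {D : Set (BondConfig V)} (hD : IsLowerSet D)
    (hDdet : ∀ ω₁ ω₂ : BondConfig V, (∀ e ∈ E, (∀ x ∈ e, x ∈ Core) → (e ∈ ω₁ ↔ e ∈ ω₂)) →
      (ω₁ ∈ D ↔ ω₂ ∈ D)) :
    (rcMeasure (fromEdgeSet (E : Set (Sym2 V))) p q (B₀ ∪ W)).real
        {ω | ∃ (a b : V) (w : (fromEdgeSet (E : Set (Sym2 V))).Walk a b), a ∈ Core ∧
          b ∉ Core ∪ Ann ∧ (∀ z ∈ w.support, z = a ∨ z = b ∨ z ∈ Ann) ∧ ∀ e ∈ w.edges, e ∈ ω}ᶜ *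
      (rcMeasure (fromEdgeSet (E : Set (Sym2 V))) p q B₀).real D ≤
      (rcMeasure (fromEdgeSet (E : Set (Sym2 V))) p q (B₀ ∪ W)).real D := by
  classical
  have hq0 : 0 < q := one_pos.trans_le hq
  haveI := isProbabilityMeasure_rcMeasure (fromEdgeSet (E : Set (Sym2 V))) hp hq0 (B₀ ∪ W)
  set φ := rcMeasure (fromEdgeSet (E : Set (Sym2 V))) p q (B₀ ∪ W) with hφ
  set Rest : Set V := {v | v ∉ Core ∧ v ∉ Ann} with hRest
  have hRest' : ∀ v, v ∈ Rest ↔ v ∉ Core ∧ v ∉ Ann := fun v ↦ Iff.rfl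
  have hWR : W ⊆ Rest := fun w hw ↦ hW w hw
  -- on each datum event, the inner law is the `B₀`-wired law of a sub-domain
  have h3 : ∀ X : Set V,
      φ.real (Set.univ ∩ explEvent Rest Ann X ∅) *
          (rcMeasure (fromEdgeSet (E : Set (Sym2 V))) p q B₀).real D ≤
        φ.real (D ∩ explEvent Rest Ann X ∅) := by
    intro X
    rw [Set.univ_inter]
    by_cases hne : (explEvent Rest Ann X ∅).Nonempty
    · obtain ⟨ω₀, hω₀⟩ := hne
      obtain ⟨U, hU, hUE, hAgree⟩ := exists_region_off_explSet hCA hRest' hω₀.1 hDdet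
      have hBX : (B₀ ∪ W) \ X = B₀ := blob_union_sdiff_explSet_eq hCA hRest' hWR hB₀ hω₀.1
      calc φ.real (explEvent Rest Ann X ∅) * (rcMeasure (fromEdgeSet (E : Set (Sym2 V))) p q B₀).real D
          ≤ φ.real (explEvent Rest Ann X ∅) *
              (rcMeasure (fromEdgeSet (U : Set (Sym2 V))) p q ((B₀ ∪ W) \ X)).real D := by
            rw [hBX]
            refine mul_le_mul_of_nonneg_left ?_ measureReal_nonneg
            calc (rcMeasure (fromEdgeSet (E : Set (Sym2 V))) p q B₀).real D
                = (rcMeasure (fromEdgeSet (E : Set (Sym2 V))) p q B₀).real {ω | ω ∩ ↑U ∈ D} :=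
                  measureReal_congr <|
                    rcMeasure_ae_eq_of_forall_subset_edgeSet _ hp hq0 B₀ fun ω hω ↦
                      (hAgree ω hω).symm
              _ ≤ (rcMeasure (fromEdgeSet (U : Set (Sym2 V))) p q B₀).real D :=
                  rcMeasure_real_le_fromEdgeSet_of_isLowerSet _ hp hq B₀ U (hUE _)
                    (rcMeasure_real_cylinder_empty_pos _ hp hp1 hq0 B₀ U) hD
        _ = φ.real ({ω | ω ∩ ↑U ∈ D} ∩ explEvent Rest Ann X ∅) :=
            (blob_inter_explEvent_empty_eq_mul _ hp hq0 (B₀ ∪ W) X U hU D).symm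
        _ = φ.real (D ∩ explEvent Rest Ann X ∅) :=
            measureReal_congr <|
              rcMeasure_ae_eq_of_forall_subset_edgeSet _ hp hq0 (B₀ ∪ W) fun ω hω ↦ by
                simp only [Set.mem_inter_iff, Set.mem_setOf_eq, hAgree ω hω]
    · rw [Set.not_nonempty_iff_eq_empty.1 hne, Set.inter_empty, measureReal_empty, zero_mul]
  calc φ.real {ω | ∃ (a b : V) (w : (fromEdgeSet (E : Set (Sym2 V))).Walk a b), a ∈ Core ∧
          b ∉ Core ∪ Ann ∧ (∀ z ∈ w.support, z = a ∨ z = b ∨ z ∈ Ann) ∧ ∀ e ∈ w.edges, e ∈ ω}ᶜ *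
        (rcMeasure (fromEdgeSet (E : Set (Sym2 V))) p q B₀).real D
      ≤ φ.real (⋃ X ∈ (Finset.univ : Finset (Set V)), (Set.univ ∩ explEvent Rest Ann X ∅)) *
          (rcMeasure (fromEdgeSet (E : Set (Sym2 V))) p q B₀).real D := by
        refine mul_le_mul_of_nonneg_right ?_ measureReal_nonneg
        refine rcMeasure_real_mono_of_forall_subset_edgeSet _ hp hq0 (B₀ ∪ W) fun ω hω hωC ↦ ?_
        exact blob_compl_radialCrossing_subset_iUnion hCA hCore hRest' Finset.univ
          (fun _ ↦ Finset.mem_univ _) hω ⟨Set.mem_univ ω, hωC⟩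
    _ = ∑ X ∈ (Finset.univ : Finset (Set V)), φ.real (Set.univ ∩ explEvent Rest Ann X ∅) *
            (rcMeasure (fromEdgeSet (E : Set (Sym2 V))) p q B₀).real D := by
        rw [← blob_sum_explEvent_empty_eq φ Rest Ann _ Set.univ, Finset.sum_mul]
    _ ≤ ∑ X ∈ (Finset.univ : Finset (Set V)), φ.real (D ∩ explEvent Rest Ann X ∅) :=
        Finset.sum_le_sum fun X _ ↦ h3 X
    _ = φ.real (⋃ X ∈ (Finset.univ : Finset (Set V)), (D ∩ explEvent Rest Ann X ∅)) :=
        blob_sum_explEvent_empty_eq φ Rest Ann _ D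
    _ ≤ φ.real D :=
        measureReal_mono (Set.iUnion₂_subset fun X _ ↦ Set.inter_subset_left) (measure_ne_top _ _)

/-! ### The toolkit with an inner wired blob -/

/-- **(A⁺) Removing the outer wiring for increasing inner events across a collar without open
radial crossings, an inner blob staying wired** (Kesten 1986, proof of Lemma (23), eq. (31), for
the random-cluster measure, `q ≥ 1`, `0 ≤ p < 1`): if under the collar measure wired outside the
collar an open radial crossing has probability `≤ 1 - c`, then for every increasing event `I`
determined by the `E`-edges inside the core, every blob `B₀ ⊆ Core` and every wired set `W` off
`Core ∪ Ann`, `c · φ^{B₀ ∪ W}_{⟨E⟩}(I) ≤ φ^{B₀}_{⟨E⟩}(I)`.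
[cite: Kesten1986, proof of Lemma (23), eq. (31)] -/
theorem rcMeasure_real_wired_le_free_of_radialBound' : ∀ {V : Type*} [Fintype V] [DecidableEq V] {p q : ℝ}, p ∈ Set.Ico (0 : ℝ) 1 → 1 ≤ q → ∀ (E EA : Finset (Sym2 V)) (Core Ann W B₀ : Set V), (∀ v ∈ Core, v ∉ Ann) → (∀ w ∈ W, w ∉ Core ∧ w ∉ Ann) → (∀ b ∈ B₀, b ∈ Core) → (∀ e ∈ E, (∃ v ∈ Core, v ∈ e) → ∀ x ∈ e, x ∈ Core ∨ x ∈ Ann) → (∀ e, e ∈ EA ↔ e ∈ E ∧ ∃ v ∈ Ann, v ∈ e) → ∀ {c : ℝ}, 0 < c → (Literature.Probability.LatticeModels.rcMeasure (SimpleGraph.fromEdgeSet (EA : Set (Sym2 V))) p q Annᶜ).real {ω | ∃ (a b : V) (w : (SimpleGraph.fromEdgeSet (E : Set (Sym2 V))).Walk a b), a ∈ Core ∧ b ∉ Core ∪ Ann ∧ (∀ z ∈ w.support, z = a ∨ z = b ∨ z ∈ Ann) ∧ ∀ e ∈ w.edges, e ∈ ω} ≤ 1 - c → ∀ {I : Set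 (Literature.Probability.Percolation.BondConfig V)}, IsUpperSet I → (∀ ω₁ ω₂ : Literature.Probability.Percolation.BondConfig V, (∀ e ∈ E, (∀ x ∈ e, x ∈ Core) → (e ∈ ω₁ ↔ e ∈ ω₂)) → (ω₁ ∈ I ↔ ω₂ ∈ I)) → c * (Literature.Probability.LatticeModels.rcMeasure (SimpleGraph.fromEdgeSet (E : Set (Sym2 V))) p q (B₀ ∪ W)).real I ≤ (Literature.Probability.LatticeModels.rcMeasure (SimpleGraph.fromEdgeSet (E : Set (Sym2 V))) p q B₀).real I := by
  intro V _ _ p q hp hq E EA Core Ann W B₀ hCA hW hB₀ hCore hEA c hc hcross I hI hIdet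
  have hp' : p ∈ Set.Icc (0 : ℝ) 1 := ⟨hp.1, hp.2.le⟩
  have hq0 : 0 < q := one_pos.trans_le hq
  haveI := isProbabilityMeasure_rcMeasure (fromEdgeSet (E : Set (Sym2 V))) hp' hq0 (B₀ ∪ W)
  have hBA : ∀ b ∈ B₀ ∪ W, b ∉ Ann := by
    rintro b (hb | hb)
    · exact hCA b (hB₀ b hb)
    · exact (hW b hb).2
  have hS1 := blob_radialCrossing_inter_le hp' hq E EA Core Ann (B₀ ∪ W) hCA hBA hCore hEA hcross hIdet
  have hS2 := blob_inter_compl_radialCrossing_le hp' hp.2 hq E Core Ann W B₀ hCA hW hB₀ hCore hI hIdet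
  have hsplit := measureReal_inter_add_sdiff
    (μ := rcMeasure (fromEdgeSet (E : Set (Sym2 V))) p q (B₀ ∪ W)) (s := I)
    (t := {ω | ∃ (a b : V) (w : (fromEdgeSet (E : Set (Sym2 V))).Walk a b), a ∈ Core ∧
      b ∉ Core ∪ Ann ∧ (∀ z ∈ w.support, z = a ∨ z = b ∨ z ∈ Ann) ∧ ∀ e ∈ w.edges, e ∈ ω})
    MeasurableSet.of_discrete
  rw [Set.sdiff_eq] at hsplit
  rw [Set.inter_comm] at hS1
  linarith

/-- **(B'⁺) Adding the outer wiring for decreasing inner events across a collar without open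
radial crossings, an inner blob staying wired** (Kesten 1986, proof of Lemma (23), eq. (31), for
the random-cluster measure, `q ≥ 1`, `0 ≤ p < 1`): under the hypotheses of (A⁺), for every
decreasing event `D` determined by the `E`-edges inside the core,
`c · φ^{B₀}_{⟨E⟩}(D) ≤ φ^{B₀ ∪ W}_{⟨E⟩}(D)`.
[cite: Kesten1986, proof of Lemma (23), eq. (31)] -/
theorem rcMeasure_real_free_le_wired_of_radialBound' : ∀ {V : Type*} [Fintype V] [DecidableEq V] {p q : ℝ}, p ∈ Set.Ico (0 : ℝ) 1 → 1 ≤ q → ∀ (E EA : Finset (Sym2 V)) (Core Ann W B₀ : Set V), (∀ v ∈ Core, v ∉ Ann) → (∀ w ∈ W, w ∉ Core ∧ w ∉ Ann) → (∀ b ∈ B₀, b ∈ Core) → (∀ e ∈ E, (∃ v ∈ Core, v ∈ e) → ∀ x ∈ e, x ∈ Core ∨ x ∈ Ann) → (∀ e, e ∈ EA ↔ e ∈ E ∧ ∃ v ∈ Ann, v ∈ e) → ∀ {c : ℝ}, 0 < c → (Literature.Probability.LatticeModels.rcMeasure (SimpleGraph.fromEdgeSet (EA : Set (Sym2 V)))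 p q Annᶜ).real {ω | ∃ (a b : V) (w : (SimpleGraph.fromEdgeSet (E : Set (Sym2 V))).Walk a b), a ∈ Core ∧ b ∉ Core ∪ Ann ∧ (∀ z ∈ w.support, z = a ∨ z = b ∨ z ∈ Ann) ∧ ∀ e ∈ w.edges, e ∈ ω} ≤ 1 - c → ∀ {D : Set (Literature.Probability.Percolation.BondConfig V)}, IsLowerSet D → (∀ ω₁ ω₂ : Literature.Probability.Percolation.BondConfig V, (∀ e ∈ E, (∀ x ∈ e, x ∈ Core) → (e ∈ ω₁ ↔ e ∈ ω₂)) → (ω₁ ∈ D ↔ ω₂ ∈ D)) → c * (Literature.Probability.LatticeModels.rcMeasure (SimpleGraph.fromEdgeSet (E : Set (Sym2 V))) p q B₀).real D ≤ (Literature.Probability.LatticeModels.rcMeasure (SimpleGraph.fromEdgeSet (E : Set (Sym2 V))) p q (B₀ ∪ W)).real D := by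
  intro V _ _ p q hp hq E EA Core Ann W B₀ hCA hW hB₀ hCore hEA c hc hcross D hD hDdet
  have hp' : p ∈ Set.Icc (0 : ℝ) 1 := ⟨hp.1, hp.2.le⟩
  have hq0 : 0 < q := one_pos.trans_le hq
  haveI := isProbabilityMeasure_rcMeasure (fromEdgeSet (E : Set (Sym2 V))) hp' hq0 (B₀ ∪ W)
  have hBA : ∀ b ∈ B₀ ∪ W, b ∉ Ann := by
    rintro b (hb | hb)
    · exact hCA b (hB₀ b hb)
    · exact (hW b hb).2
  -- the crossing probability under `φ^{B₀ ∪ W}_{⟨E⟩}` is at most `1 - c`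
  have hS1 := blob_radialCrossing_inter_le hp' hq E EA Core Ann (B₀ ∪ W) hCA hBA hCore hEA hcross
    (F := Set.univ) (fun _ _ _ ↦ Iff.rfl)
  rw [Set.inter_univ, probReal_univ, mul_one] at hS1
  have hcompl := probReal_compl_eq_one_sub
    (μ := rcMeasure (fromEdgeSet (E : Set (Sym2 V))) p q (B₀ ∪ W))
    (s := {ω | ∃ (a b : V) (w : (fromEdgeSet (E : Set (Sym2 V))).Walk a b), a ∈ Core ∧
      b ∉ Core ∪ Ann ∧ (∀ z ∈ w.support, z = a ∨ z = b ∨ z ∈ Ann) ∧ ∀ e ∈ w.edges, e ∈ ω})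
    MeasurableSet.of_discrete
  have hS2 := blob_compl_radialCrossing_mul_le hp' hp.2 hq E Core Ann W B₀ hCA hW hB₀ hCore hD hDdet
  have hc' : c ≤ (rcMeasure (fromEdgeSet (E : Set (Sym2 V))) p q (B₀ ∪ W)).real
      {ω | ∃ (a b : V) (w : (fromEdgeSet (E : Set (Sym2 V))).Walk a b), a ∈ Core ∧
        b ∉ Core ∪ Ann ∧ (∀ z ∈ w.support, z = a ∨ z = b ∨ z ∈ Ann) ∧ ∀ e ∈ w.edges, e ∈ ω}ᶜ := by
    rw [hcompl]
    linarith
  exact (mul_le_mul_of_nonneg_right hc' measureReal_nonneg).trans hS2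

end Collar

end Literature.Probability.LatticeModels

end
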